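import Literature.NumberTheory.Rogawski1990.LocalTransferTorusSingularJunctionInvCM   -- ★ p841663 F0P2-p02 (g8): the S2 torus junction whose binder `hI0` this file pays (token grammar)
import Literature.NumberTheory.Automorphic.CompactGroupOrbitalIntegralCanonical          -- ★ p841205 (C-an): `IsCanonical.exists_isLocallyConstant_classOrbitalIntegral_eq`
import HarnessLib

/-!
# THE COMPACT SIDE VANISHES AT A TORUS BASE POINT — the S2 binder `hI0` of the torus–singular junction, paid modulo descent at the compact dock and the
# κ-alternation of `Δ‴_v` on the compact side (Rogawski 1990 Prop. 8.2.1 (c); Langlands–Shelstad descent §2.4; Labesse–Langlands 1979 §2)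

Topic `NumberTheory/Rogawski1990`; namespace `Literature.NumberTheory.Rogawski1990`.  THEOREMS ONLY (no definition, no instance, no notation, no named fact, no `sorry`).
Cell `pub/hodgecm-mathlib` (D-0151), crux H413 = stmt-HodgeConjecture-24833, floor-2 line «N6nsGerm» (`Cruxes/H413/Lines/F0_P3a_N6nsGerm.lean`, stub `stub_N6nsS2`);
LEAD F0P3a-plan (g9) WORD T8-134 (b) «S2 `hI0` → F0P3-p01 (g13)» (SPEC `F0/P3/F0P3-p01/g12/SPEC-S2-hI0-CompactSideVanishes.F0P3p01g12.md`, F0P2-p02 (g8) «=» 06:49Z; consumer = the S2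
DRESS of A-p19 (g22), T8-136).  The S2 twin of ★ B-p08 `exists_nhds_finsum_side_eq_stableOrbitalIntegralRel_of_compact_dock` (S1, where the compact side is NOT zero and is paid
by the Euler–Poincaré letter (R2)); same binder grammar (abstract compact dock `C′`, canonical family `m′`, base point `ε_C`, descent `hD0′`), conclusion = ★ p841663's `hI0` VERBATIM.
HONEST LABEL: HC_CM is proved only modulo the printed citations (2 remaining named inputs hLiu418, h413) until rung 0 closes; this file pays `hI0` ONLY MODULO its own two binders.

THE MATHEMATICS (Prop. 8.2.1 (c)).  `ε_H = (A_{a,b}, a) ∈ H_v` is `H`-regular and `G`-singular; `t` runs over the torus `Z_{H_v}(ε_H)` near the base point `b₀` (`↑b₀ = ε_H`), `γ_H = ↑t`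
`G`-regular.  The stable class of `ι(γ_H)` in `G′_v` has four classes `e = (e_α, e_β, e_ℓ) ∈ (ℤ∕2)³`, `Σ e = 0`, indexed by the norm tests on the three eigenlines; the classes meeting
the COMPACT dock `C′ = Z_{G′_v}(ε′) ≅ U(2)_an × L_w¹` (the `Q′`-side) are `{e_α + e_ℓ = 1} = {(1,1,0), (0,1,1)}`, and `κ_v(γ_H, ·)` reads the `u(t)`-eigenline `ℓ` (★ `finKappaAt_conj_eq_iff_normTest`),
so the two `Q′`-side classes carry OPPOSITE `Δ‴_v(γ_H, ·)` — their `Δ‴_v`-sum is ZERO (binder `hΔ0`; contrast S1, where `e_ℓ = 1` on the whole compact side and `Δ‴_v` is constant).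
By descent at the compact dock (binder `hD0′`, the (D2ε′) currency of ★ A-p17 read at the torus) each `Q′`-side orbital integral is a canonical orbital integral `Φ^{C′}(⟦m⟧, ψ_ε; m′)`
at a point `m` of any prescribed neighbourhood `B′` of `ε_C`; ★ (C-an) makes `m ↦ Φ^{C′}(⟦m⟧, ψ_ε; m′)` ONE locally constant `Ψ` through the centre, so with `B′ := {Ψ = Ψ ε_C}` every
`Q′`-side orbital integral equals `Ψ(ε_C)` near `b₀`; unmatched classes have `Δ‴_v = 0` (★ `finExplicitDelta_of_not_isLocalNormPair`).  Hence the `Q′`-side sum is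
`Ψ(ε_C) · Σ_{Q′-side, matched} Δ‴_v(γ_H, c) = 0` EXACTLY on a neighbourhood of `b₀` — no Euler–Poincaré letter, no `D_{G∕H} → 0` estimate.

* §1 `finsum_mem_eq_zero_of_pairing` — a finite sum over a set carrying a fixed-point-free `f`-reversing involution vanishes (the shape in which the (K-e)∕(J2a) files deliver `hΔ0`:
  the `Q′`-side classes come in pairs `{c, c̄}` with `Δ‴_v(γ_H, c̄) = −Δ‴_v(γ_H, c)`).
* §2 **`exists_nhds_finsum_side_eq_zero_of_compact_dock`** — the junction: conclusion = ★ p841663's binder `hI0` VERBATIM (abstract `Q′ : ↥Z(ε_H) → G′_v → Prop`).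

## References
* [Rogawski1990] J. D. Rogawski, *Automorphic Representations of Unitary Groups in Three Variables*, Ann. of Math. Stud. 123 (1990): §8.2 Prop. 8.2.1 (c) pp. 113–115; §8.1 Prop. 8.1.3
  pp. 110–111; §4.3 (4.3.1)–(4.3.2) p. 43; §4.9 p. 55.
* [LanglandsShelstad1990Descent] R. P. Langlands, D. Shelstad, *Descent for transfer factors*, The Grothendieck Festschrift II (1990): Thm. 2.3.A, §2.4.
* [LabesseLanglands1979] J.-P. Labesse, R. P. Langlands, *L-indistinguishability for SL(2)*, Canad. J. Math. 31 (1979): §2.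
-/

set_option autoImplicit false

noncomputable section

open Set Filter Topology MeasureTheory Measure
open scoped Matrix MatrixGroups

namespace Literature.NumberTheory.Rogawski1990

open Literature.NumberTheory.Automorphic Literature.NumberTheory.Automorphic.UnitaryGroup Literature.NumberTheory.GaloisRepresentations
open _root_.NumberField _root_.IsDedekindDomain

/-! ## §1 A finite sum over a set with a fixed-point-free sign-reversing involution vanishes -/

section Pairing

/-- **Pair cancellation**: if a finite set `s` carries a map `σ` with `σ(s) ⊆ s`, `σ ∘ σ = id` on `s`, `σ c ≠ c` wherever `f c ≠ 0`, and `f (σ c) = −f c` on `s`, then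
`Σᶠ_{c ∈ s} f c = 0` (★ `Finset.sum_involution`).  The shape of the κ-alternation on the compact side at an `H`-regular torus point: the matched `Q′`-side classes pair off
`c ↔ c̄` with `Δ‴_v(γ_H, c̄) = −Δ‴_v(γ_H, c)`. [cite: Rogawski1990, §4.3 (4.3.2) p. 43; §8.2 Prop. 8.2.1 (c) pp. 113–115] [cite: LabesseLanglands1979, §2] -/
theorem finsum_mem_eq_zero_of_pairing {ι M : Type*} [AddCommGroup M] {s : Set ι} (hs : s.Finite) (f : ι → M) (σ : ι → ι)
    (hσs : ∀ c ∈ s, σ c ∈ s) (hσσ : ∀ c ∈ s, σ (σ c) = c) (hσne : ∀ c ∈ s, f c ≠ 0 → σ c ≠ c) (hf : ∀ c ∈ s, f (σ c) = -f c) :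
    ∑ᶠ c ∈ s, f c = 0 := by
  classical
  rw [finsum_mem_eq_finite_toFinset_sum f hs]
  refine Finset.sum_involution (fun c _ => σ c) (fun c hc => ?_) (fun c hc => hσne c (hs.mem_toFinset.1 hc))
    (fun c hc => hs.mem_toFinset.2 (hσs c (hs.mem_toFinset.1 hc))) (fun c hc => hσσ c (hs.mem_toFinset.1 hc))
  rw [hf c (hs.mem_toFinset.1 hc), add_neg_cancel]

end Pairing

/-! ## §2 The S2 compact-side junction: `hI0` from descent at the compact dock and the vanishing `Δ‴_v`-sum -/

section CompactSideZero

variable (L : Type) [Field L] [NumberField L] [IsCMField L] (H' : Matrix (Fin 3) (Fin 3) L) (v : HeightOneSpectrum (𝓞 ↥(maximalRealSubfield L)))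

variable [iM' : ∀ γ : (cmDatum L 3 H').Local v, MeasurableSpace ((cmDatum L 3 H').Local v ⧸ Subgroup.centralizer ({γ} : Set ((cmDatum L 3 H').Local v)))]

/-- **THE COMPACT SIDE VANISHES NEAR AN `H`-REGULAR TORUS BASE POINT** — F0P2-p02's binder `hI0` of ★ `exists_nhds_stableOrbitalIntegralRel_eq_of_torus_singular_inv` (S2, Prop.
8.2.1 (c)), PAID modulo two binders in the grammar of ★ `exists_nhds_finsum_side_eq_stableOrbitalIntegralRel_of_compact_dock`: `hD0′` — DESCENT at the compact dock read on an
abstract COMPACT group `C′` (canonical family `m′` for `P′`, base point `ε_C`), at the torus: near `b₀`, every matched `Q′ t`-side class has orbital integral `Φ^{C′}(⟦m⟧, ψ_ε; m′)`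
at a pinned point `m` of any prescribed `B′ ∈ 𝓝 ε_C`; `hΔ0` — near `b₀` the `Δ‴_v(↑t, ·)`-sum over the matched `Q′ t`-side classes is ZERO (the two compact-side classes carry
opposite `κ_v`; §1 is the shape).  Data: the explicit factor `Δ‴_v` (`μ hl hr`), ANY family `m_G` on `G′_v`, the point `ε_H`, the torus base point `b₀ ∈ Z_{H_v}(ε_H)`, the abstract
bad side `Q′ : ↥Z(ε_H) → G′_v → Prop`.  CONCLUSION (= `hI0` verbatim): for every `ψ ∈ C_c^∞(G′_v)` there is `V ∈ 𝓝 b₀` with `Σᶠ_{c : Q′ t (out c)} Δ‴_v(↑t, out c)·Φ(c, ψ; m_G) = 0`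
for all `t ∈ V` with `↑t` `G`-regular.  Proof: unmatched classes have `Δ‴_v = 0` (★ `finExplicitDelta_of_not_isLocalNormPair`); ★ (C-an) gives ONE locally constant `Ψ` on `C′`
with `Φ^{C′}(⟦m⟧, ψ_ε; m′) = Ψ m` at pinned `m`; take `B′ := {Ψ = Ψ ε_C}`; then the sum is `(Σᶠ_{matched Q′-side} Δ‴_v) · Ψ(ε_C) = 0 · Ψ(ε_C)`.
[cite: Rogawski1990, §8.2 Prop. 8.2.1 (c) pp. 113–115; §8.1 Prop. 8.1.3 pp. 110–111; §4.3 (4.3.1)–(4.3.2) p. 43] [cite: LanglandsShelstad1990Descent, §2.4] [cite: LabesseLanglands1979, §2] -/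
theorem exists_nhds_finsum_side_eq_zero_of_compact_dock (μ : HeckeCharacter L)
    (hl : ∀ (v : HeightOneSpectrum (𝓞 ↥(maximalRealSubfield L))) (a : ((cmDatum L 2 (Matrix.of fun i j : Fin 2 => if i.val + j.val + 1 = 2 then (1 : L) else 0)).Local v ×
      (cmDatum L 1 (Matrix.of fun i j : Fin 1 => if i.val + j.val + 1 = 1 then (1 : L) else 0)).Local v)) (b : (cmDatum L 3 H').Local v) (x : ((cmDatum L 2 (Matrix.of fun i j : Fin 2 => if i.val + j.val + 1 = 2 then (1 : L) else 0)).Local v ×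
      (cmDatum L 1 (Matrix.of fun i j : Fin 1 => if i.val + j.val + 1 = 1 then (1 : L) else 0)).Local v)),
      finExplicitDelta L v H' (x * a * x⁻¹) μ b = finExplicitDelta L v H' a μ b)
    (hr : ∀ (v : HeightOneSpectrum (𝓞 ↥(maximalRealSubfield L))) (a : ((cmDatum L 2 (Matrix.of fun i j : Fin 2 => if i.val + j.val + 1 = 2 then (1 : L) else 0)).Local v ×
      (cmDatum L 1 (Matrix.of fun i j : Fin 1 => if i.val + j.val + 1 = 1 then (1 : L) else 0)).Local v)) (b y : (cmDatum L 3 H').Local v),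
      finExplicitDelta L v H' a μ (y * b * y⁻¹) = finExplicitDelta L v H' a μ b)
    {mG : OrbitalMeasureFamily ((cmDatum L 3 H').Local v)}
    -- the H-regular, G-singular point, the torus base point, the abstract bad side
    (εH : ((cmDatum L 2 (Matrix.of fun i j : Fin 2 => if i.val + j.val + 1 = 2 then (1 : L) else 0)).Local v ×
      (cmDatum L 1 (Matrix.of fun i j : Fin 1 => if i.val + j.val + 1 = 1 then (1 : L) else 0)).Local v))
    (b₀ : ↥(Subgroup.centralizer ({εH} : Set ((cmDatum L 2 (Matrix.of fun i j : Fin 2 => if i.val + j.val + 1 = 2 then (1 : L) else 0)).Local v ×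
      (cmDatum L 1 (Matrix.of fun i j : Fin 1 => if i.val + j.val + 1 = 1 then (1 : L) else 0)).Local v))))
    (Q' : ↥(Subgroup.centralizer ({εH} : Set ((cmDatum L 2 (Matrix.of fun i j : Fin 2 => if i.val + j.val + 1 = 2 then (1 : L) else 0)).Local v ×
      (cmDatum L 1 (Matrix.of fun i j : Fin 1 => if i.val + j.val + 1 = 1 then (1 : L) else 0)).Local v))) → (cmDatum L 3 H').Local v → Prop)
    -- the compact dock at the second class (abstract)
    (C' : Type) [Group C'] [TopologicalSpace C'] [IsTopologicalGroup C'] [CompactSpace C'] [LocallyCompactSpace C'] [SecondCountableTopology C'] [T2Space C']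
    [MeasurableSpace C'] [BorelSpace C']
    [∀ m : C', MeasurableSpace (C' ⧸ Subgroup.centralizer ({m} : Set C'))] [∀ m : C', BorelSpace (C' ⧸ Subgroup.centralizer ({m} : Set C'))]
    (ν' : Measure C') [ν'.IsHaarMeasure] [ν'.IsMulRightInvariant] (P' : C' → Prop) {m' : OrbitalMeasureFamily C'} (hm' : m'.IsCanonical P' ν') (εC : C')
    -- (D2ε′) at the torus: DESCENT of the matched `Q′ t`-side orbital integrals to `C′`, pinned inside any prescribed `B′ ∈ 𝓝 ε_C`, for `t` near `b₀`
    (hD0' : ∀ ψ : (cmDatum L 3 H').Local v → ℂ, IsLocSmooth ψ → ∃ ψε : C' → ℂ, IsLocallyConstant ψε ∧ ∀ B' ∈ 𝓝 εC, ∃ V ∈ 𝓝 b₀, ∀ t ∈ V,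
        IsLocalGRegular L v (t : ((cmDatum L 2 (Matrix.of fun i j : Fin 2 => if i.val + j.val + 1 = 2 then (1 : L) else 0)).Local v ×
      (cmDatum L 1 (Matrix.of fun i j : Fin 1 => if i.val + j.val + 1 = 1 then (1 : L) else 0)).Local v)) →
        ∀ c : ConjClasses ((cmDatum L 3 H').Local v), Q' t (Quotient.out c) → IsLocalNormPair L H' v (t : ((cmDatum L 2 (Matrix.of fun i j : Fin 2 => if i.val + j.val + 1 = 2 then (1 : L) else 0)).Local v ×
      (cmDatum L 1 (Matrix.of fun i j : Fin 1 => if i.val + j.val + 1 = 1 then (1 : L) else 0)).Local v)) (Quotient.out c) →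
          ∃ m ∈ B', P' (Quotient.out (ConjClasses.mk m)) ∧ classOrbitalIntegral mG ψ c = classOrbitalIntegral m' ψε (ConjClasses.mk m))
    -- (κ-alt) the `Δ‴_v`-sum over the matched `Q′ t`-side classes vanishes for `t` near `b₀`
    (hΔ0 : ∃ V ∈ 𝓝 b₀, ∀ t ∈ V, IsLocalGRegular L v (t : ((cmDatum L 2 (Matrix.of fun i j : Fin 2 => if i.val + j.val + 1 = 2 then (1 : L) else 0)).Local v ×
      (cmDatum L 1 (Matrix.of fun i j : Fin 1 => if i.val + j.val + 1 = 1 then (1 : L) else 0)).Local v)) →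
        (∑ᶠ c ∈ {c : ConjClasses ((cmDatum L 3 H').Local v) | Q' t (Quotient.out c) ∧ IsLocalNormPair L H' v (t : ((cmDatum L 2 (Matrix.of fun i j : Fin 2 => if i.val + j.val + 1 = 2 then (1 : L) else 0)).Local v ×
      (cmDatum L 1 (Matrix.of fun i j : Fin 1 => if i.val + j.val + 1 = 1 then (1 : L) else 0)).Local v)) (Quotient.out c)},
          ((finExplicitCollection L H' μ hl hr) v).Δ (t : ((cmDatum L 2 (Matrix.of fun i j : Fin 2 => if i.val + j.val + 1 = 2 then (1 : L) else 0)).Local v ×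
      (cmDatum L 1 (Matrix.of fun i j : Fin 1 => if i.val + j.val + 1 = 1 then (1 : L) else 0)).Local v)) (Quotient.out c)) = 0) :
    ∀ ψ : (cmDatum L 3 H').Local v → ℂ, IsLocSmooth ψ → ∃ V ∈ 𝓝 b₀, ∀ t ∈ V, IsLocalGRegular L v (t : ((cmDatum L 2 (Matrix.of fun i j : Fin 2 => if i.val + j.val + 1 = 2 then (1 : L) else 0)).Local v ×
      (cmDatum L 1 (Matrix.of fun i j : Fin 1 => if i.val + j.val + 1 = 1 then (1 : L) else 0)).Local v)) →
      (∑ᶠ c ∈ {c : ConjClasses ((cmDatum L 3 H').Local v) | Q' t (Quotient.out c)},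
        ((finExplicitCollection L H' μ hl hr) v).Δ (t : ((cmDatum L 2 (Matrix.of fun i j : Fin 2 => if i.val + j.val + 1 = 2 then (1 : L) else 0)).Local v ×
      (cmDatum L 1 (Matrix.of fun i j : Fin 1 => if i.val + j.val + 1 = 1 then (1 : L) else 0)).Local v)) (Quotient.out c) * classOrbitalIntegral mG ψ c) = 0 := by
  classical
  intro ψ hψ
  -- descent datum for `ψ`, read through the locally constant (C-an) function `Ψ` on the compact dock
  obtain ⟨ψε, hψε, hDψ⟩ := hD0' ψ hψ
  obtain ⟨Ψ, hΨlc, -, hΨ⟩ := hm'.exists_isLocallyConstant_classOrbitalIntegral_eq ν' hψε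
  have hB' : {m : C' | Ψ m = Ψ εC} ∈ 𝓝 εC := (hΨlc.isOpen_fiber (Ψ εC)).mem_nhds rfl
  obtain ⟨VD, hVD, hdesc⟩ := hDψ _ hB'
  obtain ⟨VΔ, hVΔ, hΔ⟩ := hΔ0
  refine ⟨VD ∩ VΔ, inter_mem hVD hVΔ, fun t ht htreg => ?_⟩
  have hsum := hΔ t ht.2 htreg
  -- pointwise: on the `Q′`-side, `Δ‴·Φ` is `Δ‴·Ψ(ε_C)` on the matched classes and `0` on the unmatched ones
  have key : {c : ConjClasses ((cmDatum L 3 H').Local v) | Q' t (Quotient.out c)}.indicator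
        (fun c => ((finExplicitCollection L H' μ hl hr) v).Δ (t : ((cmDatum L 2 (Matrix.of fun i j : Fin 2 => if i.val + j.val + 1 = 2 then (1 : L) else 0)).Local v ×
      (cmDatum L 1 (Matrix.of fun i j : Fin 1 => if i.val + j.val + 1 = 1 then (1 : L) else 0)).Local v)) (Quotient.out c) * classOrbitalIntegral mG ψ c) =
      fun c => {c : ConjClasses ((cmDatum L 3 H').Local v) | Q' t (Quotient.out c) ∧ IsLocalNormPair L H' v (t : ((cmDatum L 2 (Matrix.of fun i j : Fin 2 => if i.val + j.val + 1 = 2 then (1 : L) else 0)).Local v ×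
      (cmDatum L 1 (Matrix.of fun i j : Fin 1 => if i.val + j.val + 1 = 1 then (1 : L) else 0)).Local v)) (Quotient.out c)}.indicator
        (fun c => ((finExplicitCollection L H' μ hl hr) v).Δ (t : ((cmDatum L 2 (Matrix.of fun i j : Fin 2 => if i.val + j.val + 1 = 2 then (1 : L) else 0)).Local v ×
      (cmDatum L 1 (Matrix.of fun i j : Fin 1 => if i.val + j.val + 1 = 1 then (1 : L) else 0)).Local v)) (Quotient.out c)) c * Ψ εC := by
    funext c
    by_cases hQ : Q' t (Quotient.out c)
    · by_cases hM : IsLocalNormPair L H' v (t : ((cmDatum L 2 (Matrix.of fun i j : Fin 2 => if i.val + j.val + 1 = 2 then (1 : L) else 0)).Local v ×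
      (cmDatum L 1 (Matrix.of fun i j : Fin 1 => if i.val + j.val + 1 = 1 then (1 : L) else 0)).Local v)) (Quotient.out c)
      · obtain ⟨m, hmB, hPm, hΦ⟩ := hdesc t ht.1 htreg c hQ hM
        rw [Set.indicator_of_mem (show c ∈ {c : ConjClasses ((cmDatum L 3 H').Local v) | Q' t (Quotient.out c)} from hQ),
          Set.indicator_of_mem (show c ∈ {c : ConjClasses ((cmDatum L 3 H').Local v) | Q' t (Quotient.out c) ∧ IsLocalNormPair L H' v (t : ((cmDatum L 2 (Matrix.of fun i j : Fin 2 => if i.val + j.val + 1 = 2 then (1 : L) else 0)).Local v ×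
      (cmDatum L 1 (Matrix.of fun i j : Fin 1 => if i.val + j.val + 1 = 1 then (1 : L) else 0)).Local v)) (Quotient.out c)} from ⟨hQ, hM⟩),
          hΦ, hΨ m hPm]
        exact congrArg _ hmB
      · rw [Set.indicator_of_mem (show c ∈ {c : ConjClasses ((cmDatum L 3 H').Local v) | Q' t (Quotient.out c)} from hQ),
          Set.indicator_of_notMem (show c ∉ {c : ConjClasses ((cmDatum L 3 H').Local v) | Q' t (Quotient.out c) ∧ IsLocalNormPair L H' v (t : ((cmDatum L 2 (Matrix.of fun i j : Fin 2 => if i.val + j.val + 1 = 2 then (1 : L) else 0)).Local v ×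
      (cmDatum L 1 (Matrix.of fun i j : Fin 1 => if i.val + j.val + 1 = 1 then (1 : L) else 0)).Local v)) (Quotient.out c)} from fun h => hM h.2),
          zero_mul, finExplicitCollection_Δ, finExplicitDelta_of_not_isLocalNormPair L v H' _ μ hM, zero_mul]
    · rw [Set.indicator_of_notMem (show c ∉ {c : ConjClasses ((cmDatum L 3 H').Local v) | Q' t (Quotient.out c)} from hQ),
        Set.indicator_of_notMem (show c ∉ {c : ConjClasses ((cmDatum L 3 H').Local v) | Q' t (Quotient.out c) ∧ IsLocalNormPair L H' v (t : ((cmDatum L 2 (Matrix.of fun i j : Fin 2 => if i.val + j.val + 1 = 2 then (1 : L) else 0)).Local v ×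
      (cmDatum L 1 (Matrix.of fun i j : Fin 1 => if i.val + j.val + 1 = 1 then (1 : L) else 0)).Local v)) (Quotient.out c)} from fun h => hQ h.1),
        zero_mul]
  rw [finsum_mem_def, key, ← finsum_mul, ← finsum_mem_def, hsum, zero_mul]

end CompactSideZero

end Literature.NumberTheory.Rogawski1990

end
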